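import Summits.AtomisticToContinuum.Crystallization.Theses.ChessboardParticlePlanes
import Summits.AtomisticToContinuum.Crystallization.Theorems.ChessboardParticlePlanesLjPlaneChessboardReduction
import Summits.AtomisticToContinuum.Crystallization.Theorems.ChessboardParticlePlanesLjPlaneChessboardHorizontalBasis
import Summits.AtomisticToContinuum.Crystallization.Theorems.ChessboardParticlePlanesLjPlaneChessboardVerticalPeriod
import Summits.AtomisticToContinuum.Crystallization.Theorems.ChessboardParticlePlanesLjPlaneChessboardHeightEnumeration
import Summits.AtomisticToContinuum.Crystallization.Theorems.ChessboardParticlePlanesLjPlaneChessboardLayerPresentation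
import Summits.AtomisticToContinuum.Crystallization.Theorems.ChessboardParticlePlanesLjPlaneChessboardPlanarLattice
import Summits.AtomisticToContinuum.Crystallization.Theorems.ChessboardParticlePlanesLjPlaneChessboardMotifToLayers
import Summits.AtomisticToContinuum.Crystallization.Theorems.ChessboardParticlePlanesLjPlaneChessboardDeficitKernel
import Summits.AtomisticToContinuum.Crystallization.Theorems.ChessboardParticlePlanesLjPlaneChessboardSliceIdentity
import Summits.AtomisticToContinuum.Crystallization.Theorems.ChessboardParticlePlanesLjPlaneChessboardCrossKernelFourier
import Literature.Algebra.EuclideanLattices.DualLattice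

/-!
# Crux `LjPlaneChessboard` (stmt-AtomisticToContinuum-6709) — line `sharp-block`
(crux-strategist s2, 2026-08-17; = strategist s1's line `twolayer-margin` v3 with the block core CORRECTED at `w = 0`;
an ALTERNATIVE to the lead's line `Sketch`, published, never registered over it)

s1's cut (exact slice SOS ⇒ exact block relation `M_i = N_i + ρ_i M_{i+1}` ⇒ one three-layer block core) is kept; s2's
numerics (kit j026513/j026550) found that s1's TYPED core — slices `λ > 3` only, deformation `4e^{-3λ/4}` — has a NON-PSD
`w = 0` channel on the density simplex for nearly-equal small gaps (`min nᵀK(0)n/nᵀK⁺n = -1.09` at `(c₁,c₂) = (0.75,0.8)`,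
`n = (0.11,0.74,0.15)`), although the undeformed block form is coercive there (`+0.51`).  This line uses the SHARP weight
`max(W,0)/(1+ρ̄)² − max(−W,0)/(1−ρ̄)²`, `ρ̄(λ) = e^{-3λ/4}/√(1−e^{-3λ/2})`, on all slices `λ > max(2π‖w‖, 1/2)`: exactly the
two-sided `ℓ²` budget of the block relation (`(1+ρ̄)⁻¹‖N‖ ≤ ‖M‖ ≤ (1−ρ̄)⁻¹‖N‖`, valid as soon as `ρ̄ < 1`, i.e. `λ > 0.47`),
pointwise WEAKER than s1's core and still sufficient.  Numerics (kit j026572/j026573): `K♯(0;c₁,c₂)` is PSD as a matrix to 1e-16 for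
all gap pairs, simplex min `+0.455`; adversarial falsifier over realizable hard-core triples (288 tasks): max NEG/POS slice ratio
0.613 < 1 (kernel-limited micro-shear at `q = 10.88`), mode-sign ratio ≤ 4e-4.

* `stub_modeSliceForm` (A, M, bookkeeping over landed lemmas): kernel form `=` `4π/covol(L) · Σ'_w ∫_{λ>2π‖w‖} W·LHS_w` (s1's text).
* `stub_sharpBlockReduction` (B♯, M/L): sharp block core ⇒ `0 ≤ Σ'_w ∫ W·LHS_w` (slice identity p105431 + block relation +
  `‖R‖ ≤ ρ̄(λ)`; slices `λ ≤ 1/2` have `W ≥ 0` and are dropped).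
* `stub_sharpBlockCore` (C♯, XL, THE CORE): the sharp three-layer block reflection inequality.

Composition kernel-checked (no sorry outside the three stubs); the same three statements are the children of the route-level
split package `Cruxes/LjPlaneChessboard/ChessboardParticlePlanesLjPlaneChessboardSplit.lean` (glue `ljPlaneChessboard_of_subs`,
sorry-free) + `children_sharp.json` (evidence), to be filed with `route edit --split` on a final cycle.
Card: `Cruxes/LjPlaneChessboard/Lines/sharp-block.md`; census: `Cruxes/LjPlaneChessboard/STRATEGY-CENSUS.md` (s2).
[cite: GiulianiLebowitzLieb2008, Lemma 1; FrohlichEtAl1978, Thm 3.1; GiulianiLebowitzLieb2006, §3]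
-/

noncomputable section

namespace Summit.AtomisticToContinuum.Crystallization.Cruxes.LjPlaneChessboard.SharpBlock

open Literature.MathematicalPhysics.StatisticalMechanics
open Literature.Algebra.EuclideanLattices
open Summit.AtomisticToContinuum.Crystallization.Theorems.ChessboardParticlePlanesLjPlaneChessboard
open scoped Real InnerProductSpace FourierTransform

/-- **Stub C — THE CORE: the three-layer block reflection inequality (XL, research-level, certificate-free).**
For a planar lattice `L`, three finite motifs `F₀, F₁, F₂` whose `L`-periodisations are `2/3`-separated (the
layers `i, i+1, i+2` of a stack) and the two gaps `c₁, c₂ ≥ 3/4` between them, the mode/slice form of the block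
mismatch `Ñ = e^{-λc₂}(1-e^{-2λc₁})S_{F₂} + (e^{-2λc₂}-e^{-2λc₁})S_{F₁} - e^{-λc₁}(1-e^{-2λc₂})S_{F₀}` — i.e. the block
`(σ₀,σ₁,σ₂)` REFLECTED THROUGH ITS TOP PLANE minus the block TRANSLATED UP BY TWICE ITS BOTTOM GAP, both seen from the
middle plane — weighted by the SHARP slice weight `(max(W,0)/(1+ρ̄)² − max(−W,0)/(1−ρ̄)²)/((1-e^{-2λc₁})(1-e^{-2λc₂})²)`,
`ρ̄ = e^{-3λ/4}/√(1-e^{-3λ/2})`, on `λ > max(2π‖w‖, 1/2)`, is `≥ 0` (`S_F(w) = Σ_{f∈F} e^{2πi⟪f,w⟫}`, `W` the landed slice weight of `fourier_ljCrossKernel`).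
For equal gaps `c₁ = c₂ = c` the `S_{F₁}` term vanishes and this is EXACTLY the two-layer offset-negative-type
inequality `E2(σ₀, σ₂; 2c) ≥ 0` of the idea cards with the restack image weight `1/(1-e^{-2λc})` (worst known
mode-sign ratio NEG/POS over realizable pairs 4.06e-3, j023430; the card's radial certificate `Ψ` addresses these
instances); for `c₁ ≠ c₂` the mirror layer enters with the second-order coefficient `e^{-2λc₂} - e^{-2λc₁}` and the
`G = 0` channel is strictly coercive (log-convexity of `u ↦ K̂_u(0)`).  The sharp factors are EXACTLY the two-sided
`ℓ²` budget of `stub_sharpBlockReduction`; they leave the sign change of the block multiplier at `q*(3/2) = 12.31` and keep the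
`w = 0` channel PSD (s1's cutoff `λ > 3` did not: −1.09 on the density simplex at gaps (0.75, 0.8)).  Not a strengthening in substance: it is the crux restricted
to the stacks in which only one block is active.  [difficulty: XL] [cite: FrohlichEtAl1978, Thm 3.1;
GiulianiLebowitzLieb2008, Lemma 1] -/
theorem stub_sharpBlockCore :
    ∀ (L : Submodule ℤ (EuclideanSpace ℝ (Fin 2))) [DiscreteTopology L] [IsZLattice ℝ L]
      (F₀ F₁ F₂ : Finset (EuclideanSpace ℝ (Fin 2))) (c₁ c₂ : ℝ),
      (∀ f ∈ F₀, ∀ f' ∈ F₀, ∀ v ∈ L, f ≠ f' + v → (2 : ℝ) / 3 ≤ dist f (f' + v)) →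
      (∀ f ∈ F₁, ∀ f' ∈ F₁, ∀ v ∈ L, f ≠ f' + v → (2 : ℝ) / 3 ≤ dist f (f' + v)) →
      (∀ f ∈ F₂, ∀ f' ∈ F₂, ∀ v ∈ L, f ≠ f' + v → (2 : ℝ) / 3 ≤ dist f (f' + v)) →
      (3 : ℝ) / 4 ≤ c₁ → (3 : ℝ) / 4 ≤ c₂ →
      0 ≤ (∑' w : dualLattice L, ∫ l in Set.Ioi (max (2 * π * ‖(w : EuclideanSpace ℝ (Fin 2))‖) (1 / 2 : ℝ)),
            (max ((l ^ 2 - (2 * π * ‖(w : EuclideanSpace ℝ (Fin 2))‖) ^ 2) * Real.sqrt (l ^ 2 - (2 * π * ‖(w : EuclideanSpace ℝ (Fin 2))‖) ^ 2) / 144 - (l ^ 2 - (2 * π * ‖(w : EuclideanSpace ℝ (Fin 2))‖) ^ 2) ^ 4 * Real.sqrt (l ^ 2 - (2 * π * ‖(w : EuclideanSpace ℝ (Fin 2))‖) ^ 2) / 43545600) 0 / (1 + Real.exp (-(3 * l / 4)) / Real.sqrt (1 - Real.exp (-(3 * l / 2)))) ^ 2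
              - max (-((l ^ 2 - (2 * π * ‖(w : EuclideanSpace ℝ (Fin 2))‖) ^ 2) * Real.sqrt (l ^ 2 - (2 * π * ‖(w : EuclideanSpace ℝ (Fin 2))‖) ^ 2) / 144 - (l ^ 2 - (2 * π * ‖(w : EuclideanSpace ℝ (Fin 2))‖) ^ 2) ^ 4 * Real.sqrt (l ^ 2 - (2 * π * ‖(w : EuclideanSpace ℝ (Fin 2))‖) ^ 2) / 43545600)) 0 / (1 - Real.exp (-(3 * l / 4)) / Real.sqrt (1 - Real.exp (-(3 * l / 2)))) ^ 2)
            * (‖((Real.exp (-(l * c₂)) * (1 - Real.exp (-(2 * (l * c₁)))) : ℝ) : ℂ) * (∑ f ∈ F₂, Complex.exp (2 * π * Complex.I * (⟪f, (w : EuclideanSpace ℝ (Fin 2))⟫_ℝ : ℂ))) + ((Real.exp (-(2 * (l * c₂))) - Real.exp (-(2 * (l * c₁))) : ℝ) : ℂ) * (∑ f ∈ F₁, Complex.exp (2 * π * Complex.I * (⟪f, (w : EuclideanSpace ℝ (Fin 2))⟫_ℝ : ℂ))) - ((Real.exp (-(l * c₁)) * (1 - Real.exp (-(2 * (l * c₂))))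 : ℝ) : ℂ) * (∑ f ∈ F₀, Complex.exp (2 * π * Complex.I * (⟪f, (w : EuclideanSpace ℝ (Fin 2))⟫_ℝ : ℂ)))‖ ^ 2
               / ((1 - Real.exp (-(2 * (l * c₁)))) * (1 - Real.exp (-(2 * (l * c₂)))) ^ 2))) := by
  sorry

/-- **Stub B — hierarchy reduction (M/L, exact algebra + bookkeeping): the block core implies positivity of the
mode/slice form of the motif-summed chessboard deficit for every admissible layered presentation.**
Ingredients, all exact: (1) `stub_sliceIdentity` (p105431): `LHS_w(λ) = Σ_{i<n} |M_i|²/(1-s_i²)`,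
`M_i = (1-s_i²)U_{i+1} - s_ia_i - s_i²a_{i+1}`, `s_i = e^{-λc_i}`; (2) the Markov property `U_{i+1} = s_{i+1}(a_{i+2} + U_{i+2})`
gives the BLOCK RELATION `M_i = N_i + ρ_i M_{i+1}` with `ρ_i = (1-s_i²)s_{i+1}/(1-s_{i+1}²)` and
`N_i = [s_{i+1}(1-s_i²)a_{i+2} + (s_{i+1}²-s_i²)a_{i+1} - s_i(1-s_{i+1}²)a_i]/(1-s_{i+1}²)` (checked: job j023690 part 1);
(3) in the weighted norm `‖x‖² = Σ_i|x_i|²/(1-s_i²)` over one period (twist-invariant) the shift `(RM)_i = ρ_iM_{i+1}` has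
`‖R‖ ≤ ρ̄(λ) := s̄/√(1-s̄²)`, `s̄ = e^{-3λ/4}` (only `c_i ≥ 3/4` is used), and `ρ̄ < 1` for `λ > 1/2`, so
`(1+ρ̄)⁻¹‖N‖ ≤ ‖M‖ ≤ (1-ρ̄)⁻¹‖N‖` for ALL gap sequences; (4) hence SLICE BY SLICE, for `λ > 1/2`,
`W‖M‖² ≥ [max(W,0)(1+ρ̄)⁻² − max(−W,0)(1−ρ̄)⁻²]‖N‖²` (the SHARP weight of stub C♯ — no `α ≥ β` lemma needed), and the slices
`λ ≤ 1/2` (present only when `2π‖w‖ < 1/2`) have `W ≥ 0` (`sliceWeight_signChange`) and are dropped; (5) `|N_i|²/(1-s_i²)` is the core's integrand for `(F₀,F₁,F₂) =` planar motifs of layers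
`(i, i+1, i+2)` and `(c₁,c₂) = (c_i, c_{i+1})` (no image expansion needed); sum the core over `i < n` (Fubini/`tsum` of
nonnegatives).  Design checks: j023690 (identity + chain, random and adversarial incl. gaps up to 2.5); the earlier TWO-layer
main term `m_i = s_{i+1}a_{i+2} - s_ia_i` (v2 of this line) missed the restack image `-s_i²a_{i+1}` and its chain is beaten
adversarially at q = 8 (j023600) when `c_{i+1} > 2c_i` — recorded so nobody re-types it. -/
theorem stub_sharpBlockReduction :
    (∀ (L : Submodule ℤ (EuclideanSpace ℝ (Fin 2))) [DiscreteTopology L] [IsZLattice ℝ L]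
      (F₀ F₁ F₂ : Finset (EuclideanSpace ℝ (Fin 2))) (c₁ c₂ : ℝ),
      (∀ f ∈ F₀, ∀ f' ∈ F₀, ∀ v ∈ L, f ≠ f' + v → (2 : ℝ) / 3 ≤ dist f (f' + v)) →
      (∀ f ∈ F₁, ∀ f' ∈ F₁, ∀ v ∈ L, f ≠ f' + v → (2 : ℝ) / 3 ≤ dist f (f' + v)) →
      (∀ f ∈ F₂, ∀ f' ∈ F₂, ∀ v ∈ L, f ≠ f' + v → (2 : ℝ) / 3 ≤ dist f (f' + v)) →
      (3 : ℝ) / 4 ≤ c₁ → (3 : ℝ) / 4 ≤ c₂ →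
      0 ≤ (∑' w : dualLattice L, ∫ l in Set.Ioi (max (2 * π * ‖(w : EuclideanSpace ℝ (Fin 2))‖) (1 / 2 : ℝ)),
            (max ((l ^ 2 - (2 * π * ‖(w : EuclideanSpace ℝ (Fin 2))‖) ^ 2) * Real.sqrt (l ^ 2 - (2 * π * ‖(w : EuclideanSpace ℝ (Fin 2))‖) ^ 2) / 144 - (l ^ 2 - (2 * π * ‖(w : EuclideanSpace ℝ (Fin 2))‖) ^ 2) ^ 4 * Real.sqrt (l ^ 2 - (2 * π * ‖(w : EuclideanSpace ℝ (Fin 2))‖) ^ 2) / 43545600) 0 / (1 + Real.exp (-(3 * l / 4)) / Real.sqrt (1 - Real.exp (-(3 * l / 2)))) ^ 2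
              - max (-((l ^ 2 - (2 * π * ‖(w : EuclideanSpace ℝ (Fin 2))‖) ^ 2) * Real.sqrt (l ^ 2 - (2 * π * ‖(w : EuclideanSpace ℝ (Fin 2))‖) ^ 2) / 144 - (l ^ 2 - (2 * π * ‖(w : EuclideanSpace ℝ (Fin 2))‖) ^ 2) ^ 4 * Real.sqrt (l ^ 2 - (2 * π * ‖(w : EuclideanSpace ℝ (Fin 2))‖) ^ 2) / 43545600)) 0 / (1 - Real.exp (-(3 * l / 4)) / Real.sqrt (1 - Real.exp (-(3 * l / 2)))) ^ 2)
            * (‖((Real.exp (-(l * c₂)) * (1 - Real.exp (-(2 * (l * c₁)))) : ℝ) : ℂ) * (∑ f ∈ F₂, Complex.exp (2 * π * Complex.I * (⟪f, (w : EuclideanSpace ℝ (Fin 2))⟫_ℝ : ℂ))) + ((Real.exp (-(2 * (l * c₂))) - Real.exp (-(2 * (l * c₁))) : ℝ) : ℂ) * (∑ f ∈ F₁, Complex.exp (2 * π * Complex.I * (⟪f, (w : EuclideanSpace ℝ (Fin 2))⟫_ℝ : ℂ))) - ((Real.exp (-(l * c₁)) * (1 - Real.exp (-(2 * (l * c₂))))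 : ℝ) : ℂ) * (∑ f ∈ F₀, Complex.exp (2 * π * Complex.I * (⟪f, (w : EuclideanSpace ℝ (Fin 2))⟫_ℝ : ℂ)))‖ ^ 2
               / ((1 - Real.exp (-(2 * (l * c₁)))) * (1 - Real.exp (-(2 * (l * c₂)))) ^ 2)))) →
    ∀ (Q : PeriodicConfiguration 3) (τu τd : ℝ → ℝ) (a b g₀ : EuclideanSpace ℝ (Fin 3))
      (z : ℤ → ℝ) (n : ℕ) (F : ℤ → Finset (EuclideanSpace ℝ (Fin 3)))
      (L : Submodule ℤ (EuclideanSpace ℝ (Fin 2))) [DiscreteTopology L] [IsZLattice ℝ L],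
      (∀ x ∈ Q.points, ∀ y ∈ Q.points, x ≠ y → (2 : ℝ) / 3 ≤ dist x y) →
      (∀ x' ∈ Q.points, ∀ y ∈ Q.points, x' 2 ≠ y 2 → (3 : ℝ) / 4 ≤ |x' 2 - y 2|) →
      (∀ t : ℝ, (∃ x ∈ Q.points, x 2 = t) →
        (t < τu t ∧ (∃ x ∈ Q.points, x 2 = τu t) ∧ (∀ x ∈ Q.points, x 2 ≤ t ∨ τu t ≤ x 2)) ∧
        (τd t < t ∧ (∃ x ∈ Q.points, x 2 = τd t) ∧ (∀ x ∈ Q.points, x 2 ≤ τd t ∨ t ≤ x 2))) →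
      a ∈ Q.lattice → b ∈ Q.lattice → a 2 = 0 → b 2 = 0 → LinearIndependent ℝ ![a, b] →
      (∀ g ∈ Q.lattice, g 2 = 0 → ∃ k l : ℤ, g = (k : ℝ) • a + (l : ℝ) • b) →
      (∀ v : EuclideanSpace ℝ (Fin 2),
        v ∈ L ↔ ∃ k l : ℤ, v = (k : ℝ) • !₂[a 0, a 1] + (l : ℝ) • !₂[b 0, b 1]) →
      g₀ ∈ Q.lattice → 0 < n → StrictMono z → (∀ i : ℤ, z (i + n) = z i + g₀ 2) →
      (∀ g ∈ Q.lattice, ∃ k : ℤ, g 2 = g₀ 2 * k) →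
      (∀ y ∈ Q.points, ∃ i : ℤ, y 2 = z i) → (∀ i : ℤ, ∃ y ∈ Q.points, y 2 = z i) →
      (∀ i : ℤ, z (i + 1) = τu (z i)) → (∀ i : ℤ, τd (z (i + 1)) = z i) →
      (∀ m : ℤ, ∀ f ∈ F m, f 2 = z m ∧ f ∈ Q.points) →
      (∀ m : ℤ, ∀ f ∈ F m, ∀ f' ∈ F m, f ≠ f' → ∀ k l : ℤ, f' ≠ f + (k : ℝ) • a + (l : ℝ) • b) →
      (∀ (m : ℤ) (y : EuclideanSpace ℝ (Fin 3)),
        (y ∈ Q.points ∧ y 2 = z m) ↔ ∃ f ∈ F m, ∃ k l : ℤ, y = f + (k : ℝ) • a + (l : ℝ) • b) →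
      (∀ m : ℤ, F (m + n) = (F m).image (fun f => f + g₀)) →
      0 ≤ ∑' w : dualLattice L, ∫ l in Set.Ioi (2 * π * ‖(w : EuclideanSpace ℝ (Fin 2))‖),
          ((l ^ 2 - (2 * π * ‖(w : EuclideanSpace ℝ (Fin 2))‖) ^ 2) * Real.sqrt (l ^ 2 - (2 * π * ‖(w : EuclideanSpace ℝ (Fin 2))‖) ^ 2) / 144 - (l ^ 2 - (2 * π * ‖(w : EuclideanSpace ℝ (Fin 2))‖) ^ 2) ^ 4 * Real.sqrt (l ^ 2 - (2 * π * ‖(w : EuclideanSpace ℝ (Fin 2))‖) ^ 2) / 43545600)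
          * ∑ i ∈ Finset.range n,
            ((2 * ((∑ f ∈ F ((i : ℤ)), Complex.exp (2 * π * Complex.I * (⟪(!₂[f 0, f 1] : EuclideanSpace ℝ (Fin 2)), (w : EuclideanSpace ℝ (Fin 2))⟫_ℝ : ℂ))) * starRingEnd ℂ (∑ f ∈ F ((i : ℤ) + 1), Complex.exp (2 * π * Complex.I * (⟪(!₂[f 0, f 1] : EuclideanSpace ℝ (Fin 2)), (w : EuclideanSpace ℝ (Fin 2))⟫_ℝ : ℂ)))).re
                  * Real.exp (-(l * (z (((i : ℤ)) + 1) - z ((i : ℤ)))))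
                + (‖(∑ f ∈ F ((i : ℤ)), Complex.exp (2 * π * Complex.I * (⟪(!₂[f 0, f 1] : EuclideanSpace ℝ (Fin 2)), (w : EuclideanSpace ℝ (Fin 2))⟫_ℝ : ℂ)))‖ ^ 2 + ‖(∑ f ∈ F ((i : ℤ) + 1), Complex.exp (2 * π * Complex.I * (⟪(!₂[f 0, f 1] : EuclideanSpace ℝ (Fin 2)), (w : EuclideanSpace ℝ (Fin 2))⟫_ℝ : ℂ)))‖ ^ 2)
                  * Real.exp (-(2 * (l * (z (((i : ℤ)) + 1) - z ((i : ℤ)))))))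
                / (1 - Real.exp (-(2 * (l * (z (((i : ℤ)) + 1) - z ((i : ℤ)))))))
              - 2 * ((∑ f ∈ F ((i : ℤ)), Complex.exp (2 * π * Complex.I * (⟪(!₂[f 0, f 1] : EuclideanSpace ℝ (Fin 2)), (w : EuclideanSpace ℝ (Fin 2))⟫_ℝ : ℂ))) * starRingEnd ℂ
                  (∑' k : ℕ, (Real.exp (-(l * (z ((i : ℤ) + 1 + k) - z (i : ℤ)))) : ℂ)
                    * (∑ f ∈ F ((i : ℤ) + 1 + (k : ℤ)), Complex.exp (2 * π * Complex.I * (⟪(!₂[f 0, f 1] : EuclideanSpace ℝ (Fin 2)), (w : EuclideanSpace ℝ (Fin 2))⟫_ℝ : ℂ))))).re) := by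
  sorry

/-- **Stub A — mode/slice form of the kernel form (M, bookkeeping over landed lemmas).**
Poisson summation over `L` of each kernel entry (`kernelForm_eq_entrySum`, `latticeForm_hasSum_periodise`),
the explicit planar transform of the entries (`kernelEntry_fourier` = phases × `-2π ∫_{λ>q} W e^{-λ|Δz|}`),
exchange of the finite sums with the λ-integral, and the identification of the resulting vertical
exponential-kernel combination with `-2 ×` the left-hand side of `stub_sliceIdentity` at the structure
amplitudes `a_j(w) = Σ_{f ∈ F j} e^{2πi⟪f̄,w⟫}` (the `w ↦ -w` symmetry makes the total real). -/
theorem stub_modeSliceForm :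
    ∀ (Q : PeriodicConfiguration 3) (τu τd : ℝ → ℝ) (a b g₀ : EuclideanSpace ℝ (Fin 3))
      (z : ℤ → ℝ) (n : ℕ) (F : ℤ → Finset (EuclideanSpace ℝ (Fin 3)))
      (L : Submodule ℤ (EuclideanSpace ℝ (Fin 2))) [DiscreteTopology L] [IsZLattice ℝ L],
      (∀ x ∈ Q.points, ∀ y ∈ Q.points, x ≠ y → (2 : ℝ) / 3 ≤ dist x y) →
      (∀ x' ∈ Q.points, ∀ y ∈ Q.points, x' 2 ≠ y 2 → (3 : ℝ) / 4 ≤ |x' 2 - y 2|) →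
      (∀ t : ℝ, (∃ x ∈ Q.points, x 2 = t) →
        (t < τu t ∧ (∃ x ∈ Q.points, x 2 = τu t) ∧ (∀ x ∈ Q.points, x 2 ≤ t ∨ τu t ≤ x 2)) ∧
        (τd t < t ∧ (∃ x ∈ Q.points, x 2 = τd t) ∧ (∀ x ∈ Q.points, x 2 ≤ τd t ∨ t ≤ x 2))) →
      a ∈ Q.lattice → b ∈ Q.lattice → a 2 = 0 → b 2 = 0 → LinearIndependent ℝ ![a, b] →
      (∀ g ∈ Q.lattice, g 2 = 0 → ∃ k l : ℤ, g = (k : ℝ) • a + (l : ℝ) • b) →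
      (∀ v : EuclideanSpace ℝ (Fin 2),
        v ∈ L ↔ ∃ k l : ℤ, v = (k : ℝ) • !₂[a 0, a 1] + (l : ℝ) • !₂[b 0, b 1]) →
      g₀ ∈ Q.lattice → 0 < n → StrictMono z → (∀ i : ℤ, z (i + n) = z i + g₀ 2) →
      (∀ g ∈ Q.lattice, ∃ k : ℤ, g 2 = g₀ 2 * k) →
      (∀ y ∈ Q.points, ∃ i : ℤ, y 2 = z i) → (∀ i : ℤ, ∃ y ∈ Q.points, y 2 = z i) →
      (∀ i : ℤ, z (i + 1) = τu (z i)) → (∀ i : ℤ, τd (z (i + 1)) = z i) →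
      (∀ m : ℤ, ∀ f ∈ F m, f 2 = z m ∧ f ∈ Q.points) →
      (∀ m : ℤ, ∀ f ∈ F m, ∀ f' ∈ F m, f ≠ f' → ∀ k l : ℤ, f' ≠ f + (k : ℝ) • a + (l : ℝ) • b) →
      (∀ (m : ℤ) (y : EuclideanSpace ℝ (Fin 3)),
        (y ∈ Q.points ∧ y 2 = z m) ↔ ∃ f ∈ F m, ∃ k l : ℤ, y = f + (k : ℝ) • a + (l : ℝ) • b) →
      (∀ m : ℤ, F (m + n) = (F m).image (fun f => f + g₀)) →
      ∑ i₀ ∈ Finset.range n, ∑ x ∈ F i₀,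
        ∑ m ∈ Finset.range n, ∑ f' ∈ F m, ∑' v : L,
        ∑' j : ℤ,
          ((if (m : ℤ) + j * n = (i₀ : ℤ) then 0 else
              2 * lennardJones (Real.sqrt
                (‖!₂[x 0, x 1] - !₂[f' 0, f' 1] - (j : ℝ) • !₂[g₀ 0, g₀ 1]
                    - (v : EuclideanSpace ℝ (Fin 2))‖ ^ 2 + (z (i₀ : ℤ) - z ((m : ℤ) + j * n)) ^ 2)))
            - (if (m : ℤ) + j * n = (i₀ : ℤ) then
                ∑' k : {k : ℤ // k ≠ 0},
                  (lennardJones (Real.sqrt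
                      (‖!₂[x 0, x 1] - !₂[f' 0, f' 1] - (v : EuclideanSpace ℝ (Fin 2))‖ ^ 2
                        + (2 * |(k : ℝ)| * (z ((i₀ : ℤ) + 1) - z (i₀ : ℤ))) ^ 2)) +
                   lennardJones (Real.sqrt
                      (‖!₂[x 0, x 1] - !₂[f' 0, f' 1] - (v : EuclideanSpace ℝ (Fin 2))‖ ^ 2
                        + (2 * |(k : ℝ)| * (z (i₀ : ℤ) - z ((i₀ : ℤ) - 1))) ^ 2)))
               else 0)
            - (if (m : ℤ) + j * n = (i₀ : ℤ) + 1 then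
                ∑' k : ℤ, lennardJones (Real.sqrt
                  (‖!₂[x 0, x 1] - !₂[f' 0, f' 1] - (j : ℝ) • !₂[g₀ 0, g₀ 1]
                      - (v : EuclideanSpace ℝ (Fin 2))‖ ^ 2
                    + (|2 * (k : ℝ) + 1| * (z ((i₀ : ℤ) + 1) - z (i₀ : ℤ))) ^ 2))
               else 0)
            - (if (m : ℤ) + j * n = (i₀ : ℤ) - 1 then
                ∑' k : ℤ, lennardJones (Real.sqrt
                  (‖!₂[x 0, x 1] - !₂[f' 0, f' 1] - (j : ℝ) • !₂[g₀ 0, g₀ 1]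
                      - (v : EuclideanSpace ℝ (Fin 2))‖ ^ 2
                    + (|2 * (k : ℝ) + 1| * (z (i₀ : ℤ) - z ((i₀ : ℤ) - 1))) ^ 2))
               else 0))
        = 4 * π / ZLattice.covolume L *
        ∑' w : dualLattice L, ∫ l in Set.Ioi (2 * π * ‖(w : EuclideanSpace ℝ (Fin 2))‖),
          ((l ^ 2 - (2 * π * ‖(w : EuclideanSpace ℝ (Fin 2))‖) ^ 2) * Real.sqrt (l ^ 2 - (2 * π * ‖(w : EuclideanSpace ℝ (Fin 2))‖) ^ 2) / 144 - (l ^ 2 - (2 * π * ‖(w : EuclideanSpace ℝ (Fin 2))‖) ^ 2) ^ 4 * Real.sqrt (l ^ 2 - (2 * π * ‖(w : EuclideanSpace ℝ (Fin 2))‖) ^ 2) / 43545600)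
          * ∑ i ∈ Finset.range n,
            ((2 * ((∑ f ∈ F ((i : ℤ)), Complex.exp (2 * π * Complex.I * (⟪(!₂[f 0, f 1] : EuclideanSpace ℝ (Fin 2)), (w : EuclideanSpace ℝ (Fin 2))⟫_ℝ : ℂ))) * starRingEnd ℂ (∑ f ∈ F ((i : ℤ) + 1), Complex.exp (2 * π * Complex.I * (⟪(!₂[f 0, f 1] : EuclideanSpace ℝ (Fin 2)), (w : EuclideanSpace ℝ (Fin 2))⟫_ℝ : ℂ)))).re
                  * Real.exp (-(l * (z (((i : ℤ)) + 1) - z ((i : ℤ)))))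
                + (‖(∑ f ∈ F ((i : ℤ)), Complex.exp (2 * π * Complex.I * (⟪(!₂[f 0, f 1] : EuclideanSpace ℝ (Fin 2)), (w : EuclideanSpace ℝ (Fin 2))⟫_ℝ : ℂ)))‖ ^ 2 + ‖(∑ f ∈ F ((i : ℤ) + 1), Complex.exp (2 * π * Complex.I * (⟪(!₂[f 0, f 1] : EuclideanSpace ℝ (Fin 2)), (w : EuclideanSpace ℝ (Fin 2))⟫_ℝ : ℂ)))‖ ^ 2)
                  * Real.exp (-(2 * (l * (z (((i : ℤ)) + 1) - z ((i : ℤ)))))))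
                / (1 - Real.exp (-(2 * (l * (z (((i : ℤ)) + 1) - z ((i : ℤ)))))))
              - 2 * ((∑ f ∈ F ((i : ℤ)), Complex.exp (2 * π * Complex.I * (⟪(!₂[f 0, f 1] : EuclideanSpace ℝ (Fin 2)), (w : EuclideanSpace ℝ (Fin 2))⟫_ℝ : ℂ))) * starRingEnd ℂ
                  (∑' k : ℕ, (Real.exp (-(l * (z ((i : ℤ) + 1 + k) - z (i : ℤ)))) : ℂ)
                    * (∑ f ∈ F ((i : ℤ) + 1 + (k : ℤ)), Complex.exp (2 * π * Complex.I * (⟪(!₂[f 0, f 1] : EuclideanSpace ℝ (Fin 2)), (w : EuclideanSpace ℝ (Fin 2))⟫_ℝ : ℂ))))).re) := by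
  sorry

/-- **Composition 1 (sorry-free): the lead's open stub `stub_kernelFormNonneg`, from stubs A, B, C.** -/
theorem kernelFormNonneg_of :
    ∀ (Q : PeriodicConfiguration 3) (τu τd : ℝ → ℝ) (a b g₀ : EuclideanSpace ℝ (Fin 3))
      (z : ℤ → ℝ) (n : ℕ) (F : ℤ → Finset (EuclideanSpace ℝ (Fin 3)))
      (L : Submodule ℤ (EuclideanSpace ℝ (Fin 2))) [DiscreteTopology L] [IsZLattice ℝ L],
      (∀ x ∈ Q.points, ∀ y ∈ Q.points, x ≠ y → (2 : ℝ) / 3 ≤ dist x y) →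
      (∀ x' ∈ Q.points, ∀ y ∈ Q.points, x' 2 ≠ y 2 → (3 : ℝ) / 4 ≤ |x' 2 - y 2|) →
      (∀ t : ℝ, (∃ x ∈ Q.points, x 2 = t) →
        (t < τu t ∧ (∃ x ∈ Q.points, x 2 = τu t) ∧ (∀ x ∈ Q.points, x 2 ≤ t ∨ τu t ≤ x 2)) ∧
        (τd t < t ∧ (∃ x ∈ Q.points, x 2 = τd t) ∧ (∀ x ∈ Q.points, x 2 ≤ τd t ∨ t ≤ x 2))) →
      a ∈ Q.lattice → b ∈ Q.lattice → a 2 = 0 → b 2 = 0 → LinearIndependent ℝ ![a, b] →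
      (∀ g ∈ Q.lattice, g 2 = 0 → ∃ k l : ℤ, g = (k : ℝ) • a + (l : ℝ) • b) →
      (∀ v : EuclideanSpace ℝ (Fin 2),
        v ∈ L ↔ ∃ k l : ℤ, v = (k : ℝ) • !₂[a 0, a 1] + (l : ℝ) • !₂[b 0, b 1]) →
      g₀ ∈ Q.lattice → 0 < n → StrictMono z → (∀ i : ℤ, z (i + n) = z i + g₀ 2) →
      (∀ g ∈ Q.lattice, ∃ k : ℤ, g 2 = g₀ 2 * k) →
      (∀ y ∈ Q.points, ∃ i : ℤ, y 2 = z i) → (∀ i : ℤ, ∃ y ∈ Q.points, y 2 = z i) →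
      (∀ i : ℤ, z (i + 1) = τu (z i)) → (∀ i : ℤ, τd (z (i + 1)) = z i) →
      (∀ m : ℤ, ∀ f ∈ F m, f 2 = z m ∧ f ∈ Q.points) →
      (∀ m : ℤ, ∀ f ∈ F m, ∀ f' ∈ F m, f ≠ f' → ∀ k l : ℤ, f' ≠ f + (k : ℝ) • a + (l : ℝ) • b) →
      (∀ (m : ℤ) (y : EuclideanSpace ℝ (Fin 3)),
        (y ∈ Q.points ∧ y 2 = z m) ↔ ∃ f ∈ F m, ∃ k l : ℤ, y = f + (k : ℝ) • a + (l : ℝ) • b) →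
      (∀ m : ℤ, F (m + n) = (F m).image (fun f => f + g₀)) →
      0 ≤ ∑ i₀ ∈ Finset.range n, ∑ x ∈ F i₀,
        ∑ m ∈ Finset.range n, ∑ f' ∈ F m, ∑' v : L,
        ∑' j : ℤ,
          ((if (m : ℤ) + j * n = (i₀ : ℤ) then 0 else
              2 * lennardJones (Real.sqrt
                (‖!₂[x 0, x 1] - !₂[f' 0, f' 1] - (j : ℝ) • !₂[g₀ 0, g₀ 1]
                    - (v : EuclideanSpace ℝ (Fin 2))‖ ^ 2 + (z (i₀ : ℤ) - z ((m : ℤ) + j * n)) ^ 2)))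
            - (if (m : ℤ) + j * n = (i₀ : ℤ) then
                ∑' k : {k : ℤ // k ≠ 0},
                  (lennardJones (Real.sqrt
                      (‖!₂[x 0, x 1] - !₂[f' 0, f' 1] - (v : EuclideanSpace ℝ (Fin 2))‖ ^ 2
                        + (2 * |(k : ℝ)| * (z ((i₀ : ℤ) + 1) - z (i₀ : ℤ))) ^ 2)) +
                   lennardJones (Real.sqrt
                      (‖!₂[x 0, x 1] - !₂[f' 0, f' 1] - (v : EuclideanSpace ℝ (Fin 2))‖ ^ 2
                        + (2 * |(k : ℝ)| * (z (i₀ : ℤ) - z ((i₀ : ℤ) - 1))) ^ 2)))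
               else 0)
            - (if (m : ℤ) + j * n = (i₀ : ℤ) + 1 then
                ∑' k : ℤ, lennardJones (Real.sqrt
                  (‖!₂[x 0, x 1] - !₂[f' 0, f' 1] - (j : ℝ) • !₂[g₀ 0, g₀ 1]
                      - (v : EuclideanSpace ℝ (Fin 2))‖ ^ 2
                    + (|2 * (k : ℝ) + 1| * (z ((i₀ : ℤ) + 1) - z (i₀ : ℤ))) ^ 2))
               else 0)
            - (if (m : ℤ) + j * n = (i₀ : ℤ) - 1 then
                ∑' k : ℤ, lennardJones (Real.sqrt
                  (‖!₂[x 0, x 1] - !₂[f' 0, f' 1] - (j : ℝ) • !₂[g₀ 0, g₀ 1]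
                      - (v : EuclideanSpace ℝ (Fin 2))‖ ^ 2
                    + (|2 * (k : ℝ) + 1| * (z (i₀ : ℤ) - z ((i₀ : ℤ) - 1))) ^ 2))
               else 0)) := by
  intro Q τu τd a b g₀ z n F L _ _ hsep hgap Hτ ha hb ha2 hb2 hab hspan hLmem hg₀ hn hz hper hvert hcov
    hocc hzu hzd hFmem hFsep hFchar hFper
  rw [stub_modeSliceForm Q τu τd a b g₀ z n F L hsep hgap Hτ ha hb ha2 hb2 hab hspan hLmem hg₀ hn hz
    hper hvert hcov hocc hzu hzd hFmem hFsep hFchar hFper]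
  exact mul_nonneg (div_nonneg (by positivity) (ZLattice.covolume_pos L MeasureTheory.volume).le)
    (stub_sharpBlockReduction stub_sharpBlockCore Q τu τd a b g₀ z n F L hsep hgap Hτ ha hb ha2 hb2
      hab hspan hLmem hg₀ hn hz hper hvert hcov hocc hzu hzd hFmem hFsep hFchar hFper)

/-- **Composition 2 (sorry-free; the lead's v9 bookkeeping verbatim): the per-site chessboard deficit
inequality from the horizontal-basis lemma and `kernelFormNonneg_of`.** -/
theorem deficitCore_of :
    (∀ Q : PeriodicConfiguration 3,
      (∃ c₀ : ℝ, 0 < c₀ ∧ (∃ g ∈ Q.lattice, g 2 = c₀) ∧ ∀ g ∈ Q.lattice, ∃ k : ℤ, g 2 = c₀ * k) →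
      ∃ a ∈ Q.lattice, ∃ b ∈ Q.lattice, a 2 = 0 ∧ b 2 = 0 ∧ LinearIndependent ℝ ![a, b] ∧
        ∀ g ∈ Q.lattice, g 2 = 0 → ∃ k l : ℤ, g = (k : ℝ) • a + (l : ℝ) • b) →
    ∀ (Q : PeriodicConfiguration 3) (τu τd : ℝ → ℝ),
      (∀ x ∈ Q.points, ∀ y ∈ Q.points, x ≠ y → (2 : ℝ) / 3 ≤ dist x y) →
      (∀ x ∈ Q.points, ∀ y ∈ Q.points, x 2 ≠ y 2 → (3 : ℝ) / 4 ≤ |x 2 - y 2|) →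
      (∀ t : ℝ, (∃ x ∈ Q.points, x 2 = t) →
        (t < τu t ∧ (∃ x ∈ Q.points, x 2 = τu t) ∧ (∀ x ∈ Q.points, x 2 ≤ t ∨ τu t ≤ x 2)) ∧
        (τd t < t ∧ (∃ x ∈ Q.points, x 2 = τd t) ∧ (∀ x ∈ Q.points, x 2 ≤ τd t ∨ t ≤ x 2))) →
      0 ≤ ∑ x ∈ Q.motif,
        (2 * (∑' y : {y : EuclideanSpace ℝ (Fin 3) // y ∈ Q.points ∧ y ≠ x},
                lennardJones (dist x y.1))
          - (∑' y : {y : EuclideanSpace ℝ (Fin 3) //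
                y ∈ {p : EuclideanSpace ℝ (Fin 3) | ∃ k : ℤ, ∃ x' ∈ Q.points,
                  (x' 2 = x 2 ∨ x' 2 = τu (x 2)) ∧
                  p = x' + ((2 * (τu (x 2) - x 2)) * (k : ℝ)) •
                    EuclideanSpace.single (2 : Fin 3) (1 : ℝ)} ∧ y ≠ x},
                lennardJones (dist x y.1))
          - (∑' y : {y : EuclideanSpace ℝ (Fin 3) //
                y ∈ {p : EuclideanSpace ℝ (Fin 3) | ∃ k : ℤ, ∃ x' ∈ Q.points,
                  (x' 2 = τd (x 2) ∨ x' 2 = x 2) ∧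
                  p = x' + ((2 * (x 2 - τd (x 2))) * (k : ℝ)) •
                    EuclideanSpace.single (2 : Fin 3) (1 : ℝ)} ∧ y ≠ x},
                lennardJones (dist x y.1))) := by
  intro hHB Q τu τd hsep hgap Hτ
  classical
  obtain ⟨c₀, hc₀, ⟨g₀, hg₀, hg₀2⟩, hvert⟩ := stub_verticalPeriod Q hgap
  obtain ⟨a, ha, b, hb, ha2, hb2, hab, hspan⟩ := hHB Q ⟨c₀, hc₀, ⟨g₀, hg₀, hg₀2⟩, hvert⟩
  obtain ⟨n, z, hn, hz, hzu, hzd, hper, hocc, hcov⟩ :=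
    heightEnumeration Q τu τd c₀ hgap Hτ hc₀ ⟨g₀, hg₀, hg₀2⟩ hvert
  have hper' : ∀ i : ℤ, z (i + n) = z i + g₀ 2 := fun i => by rw [hg₀2]; exact hper i
  have hvert' : ∀ g ∈ Q.lattice, ∃ k : ℤ, g 2 = g₀ 2 * k := fun g hg => by
    rw [hg₀2]; exact hvert g hg
  have hcov' : ∀ y ∈ Q.points, ∃ i : ℤ, y 2 = z i := fun y hy => by
    obtain ⟨i, hi⟩ := hcov (y 2) ⟨y, hy, rfl⟩
    exact ⟨i, hi.symm⟩
  obtain ⟨F, _hFcard, hFmem, hFsep, hFchar, hFper⟩ :=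
    layerPresentation_periodic Q a b g₀ z n ha hb ha2 hb2 hab hspan hg₀ hn hz hper' hcov'
  obtain ⟨L, hLd, hLz, hLmem⟩ := planarLattice a b ha2 hb2 hab
  haveI : DiscreteTopology L := hLd
  haveI : IsZLattice ℝ L := hLz
  rw [deficit_motif_to_layers Q τu τd a b g₀ z n F Hτ ha hb ha2 hb2 hspan hg₀ hn hz hper' hvert'
    hcov' hFmem hFsep hFchar hFper]
  rw [Finset.sum_congr rfl fun i₀ hi₀ => Finset.sum_congr rfl fun x hx =>
    deficitSite_kernelForm Q τu τd a b g₀ z n F L i₀ x hgap ha hb ha2 hb2 hab hLmem hg₀ hn hz hper'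
      hcov' hocc hzu hzd hFmem hFsep hFchar hFper (Finset.mem_range.1 hi₀) hx]
  exact kernelFormNonneg_of Q τu τd a b g₀ z n F L hsep hgap Hτ ha hb ha2 hb2 hab hspan hLmem hg₀ hn hz
    hper' hvert' hcov' hocc hzu hzd hFmem hFsep hFchar hFper

/-- **Composition 3 (sorry-free): the landed reduction `stub_reduction` (p113745) applied to the per-site
deficit inequality closes the crux BY NAME.** -/
theorem LjPlaneChessboard_of :
    Summit.AtomisticToContinuum.Crystallization.Theses.ChessboardParticlePlanes.LjPlaneChessboard :=
  stub_reduction (deficitCore_of stub_horizontalBasis)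

end Summit.AtomisticToContinuum.Crystallization.Cruxes.LjPlaneChessboard.SharpBlock

end
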